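import Literature.Topology.FourManifolds.BallGluingCharts
import Literature.Topology.FourManifolds.RadialExtension
import HarnessLib

/-!
# The seam of a gluing of two discs: height, retraction and the fold-out map

Trunk T-4MAN (`Literature/Topology/FourManifolds`). Third of the files discharging, for two
closed discs, the tree's named fact `Literature.Topology.FourManifolds.nonempty_diffeomorph_of_isBoundaryGluing` (`Gluing.lean`;
Hirsch (1976), Ch. 8, Thm. 2.1), after `CollarUniquenessBall.lean` and `BallGluingCharts.lean`.

For gluing data `G : BallGluingData n φ P` of `P = 𝔻ⁿ⁺¹ ∪_φ 𝔻ⁿ⁺¹` (Hausdorff) we construct, by a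
smooth partition of unity `G.seamPOU` on `P` subordinate to the seam-adapted charts
`G.seamChart w` (`BallGluingCharts.lean`), the flow-free ingredients of a bicollar of the seam
`G.seam = jA (𝕊ⁿ) = jB (𝕊ⁿ)`:

* `G.height : P → ℝ`, a `C^∞` function vanishing exactly to first order on the seam, `≤ 0` on
  the first disc and `≥ 0` on the second (a convex combination of the first coordinates of the
  adapted charts);
* `G.retrVec : P → ℝⁿ⁺¹`, a `C^∞` map which on the seam is the "second-disc label"
  `jA z ↦ φ z` (a convex combination of the local retractions onto the seam read through `jB⁻¹`);
* `G.fold : P → ℝⁿ⁺¹`, the **fold-out map** `p ↦ (1 + height p) • φ⁻¹ (retrVec p / ‖retrVec p‖)`,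
  `C^∞` near the seam, with `fold (jA z) = z`, `‖fold p‖ < 1` on the interior of the first disc
  and `‖fold p‖ > 1` on the interior of the second disc (near the seam);
* **the derivative of `fold` at every seam point is invertible**
  (`G.injective_fderiv_foldChart`): read in the adapted chart at `w`, tangentially `fold` is
  inverted by the smooth map `u ↦ chart (jB (φ (u/‖u‖)))`, and normally the derivative of
  `height` is positive (it dominates one term of the convex combination, whose normal derivative
  is a nonzero — by invertibility of chart transitions preserving the seam hyperplane — limit of
  nonnegative difference quotients);
* hence the data for local inverses by the inverse function theorem: the derivative as an
  automorphism (`G.foldChartDeriv`) and a neighbourhood on which the fold-out map is `C^∞` with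
  invertible derivative (`G.exists_foldChart_nhds`); the local inverses themselves are
  `G.foldLocal` in `BallGluingFoldOut.lean`.

`BallGluingFoldOut.lean` globalises this to a diffeomorphism from a neighbourhood of the seam
onto a spherical shell `{1 - ε < ‖x‖ < 1 + ε}` (a bicollar), and `BallGluingUniqueness.lean`
concludes. This replaces, for discs, the collar/bicollar existence theorem (Hirsch (1976),
Thm. 4.6.1, proved there by integrating a vector field) by an inverse-function-theorem argument
available in Mathlib.

## References

* M. W. Hirsch, *Differential Topology*, GTM 33, Springer (1976), Ch. 4 §6 (collars: Thm. 6.1 and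
  the bicollaring of two-sided submanifolds), Ch. 8 §2 (gluing).
* J. R. Munkres, *Elementary Differential Topology*, Ann. of Math. Studies 54 (1966), §5–6
  (product neighbourhoods of the boundary by retraction and normal coordinate).
-/

open scoped Manifold ContDiff Topology
open Set Function Metric Filter
open scoped RealInnerProductSpace

noncomputable section

namespace Literature.Topology.FourManifolds

attribute [local instance] fact_finrank_euclideanSpace_succ

/-! ### Calculus along lines -/

section LineCalculus

variable {E F : Type*} [NormedAddCommGroup E] [NormedSpace ℝ E] [NormedAddCommGroup F]
  [NormedSpace ℝ F]

/-- The affine line `s ↦ u + s • v` has derivative `v`. [folklore] -/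
theorem hasDerivAt_lineMap' (u v : E) (s : ℝ) : HasDerivAt (fun t : ℝ => u + t • v) v s := by
  simpa using ((hasDerivAt_id s).smul_const v).const_add u

/-- **Derivatives along a line on which the function is constant vanish.** If `g` is
differentiable at `u` and `s ↦ g (u + s • v)` is eventually constant near `s = 0`, then
`Dg(u) v = 0`. [folklore] -/
theorem hasFDerivAt_apply_eq_zero_of_eventually_const {g : E → F} {g' : E →L[ℝ] F} {u v : E}
    (hg : HasFDerivAt g g' u) (h : ∀ᶠ s in 𝓝 (0 : ℝ), g (u + s • v) = g u) : g' v = 0 := by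
  have h1 : HasDerivAt (fun s : ℝ => g (u + s • v)) (g' v) 0 :=
    hg.comp_hasDerivAt_of_eq (0 : ℝ) (hasDerivAt_lineMap' u v 0) (by simp)
  have h2 : HasDerivAt (fun s : ℝ => g (u + s • v)) 0 0 :=
    (hasDerivAt_const (0 : ℝ) (g u)).congr_of_eventuallyEq h
  exact h1.unique h2

/-- **Chain rule along a line for a left inverse.** If `ℓ (g (u + s • v)) = u + s • v` for `s`
near `0`, then `Dℓ(g u) (Dg(u) v) = v`. [folklore] -/
theorem hasFDerivAt_apply_apply_eq_of_eventually_leftInverse {g : E → F} {ℓ : F → E}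
    {g' : E →L[ℝ] F} {ℓ' : F →L[ℝ] E} {u v : E} (hg : HasFDerivAt g g' u)
    (hℓ : HasFDerivAt ℓ ℓ' (g u)) (h : ∀ᶠ s in 𝓝 (0 : ℝ), ℓ (g (u + s • v)) = u + s • v) :
    ℓ' (g' v) = v := by
  have h1 : HasDerivAt (fun s : ℝ => ℓ (g (u + s • v))) (ℓ' (g' v)) 0 := by
    have hg1 : HasDerivAt (fun s : ℝ => g (u + s • v)) (g' v) 0 :=
      hg.comp_hasDerivAt_of_eq (0 : ℝ) (hasDerivAt_lineMap' u v 0) (by simp)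
    exact hℓ.comp_hasDerivAt_of_eq (0 : ℝ) hg1 (by simp)
  have h2 : HasDerivAt (fun s : ℝ => ℓ (g (u + s • v))) v 0 :=
    (hasDerivAt_lineMap' u v 0).congr_of_eventuallyEq h
  exact h1.unique h2

/-- **One-sided sign of a derivative.** If `g u = 0` and `g (u + s • v) ≥ 0` for small `s > 0`,
then `Dg(u) v ≥ 0`. [folklore] -/
theorem hasFDerivAt_nonneg_of_eventually_nonneg {g : E → ℝ} {g' : E →L[ℝ] ℝ} {u v : E}
    (hg : HasFDerivAt g g' u) (h0 : g u = 0) (h : ∀ᶠ s in 𝓝[>] (0 : ℝ), 0 ≤ g (u + s • v)) :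
    0 ≤ g' v := by
  have h1 : HasDerivAt (fun s : ℝ => g (u + s • v)) (g' v) 0 :=
    hg.comp_hasDerivAt_of_eq (0 : ℝ) (hasDerivAt_lineMap' u v 0) (by simp)
  have h2 := h1.tendsto_slope_zero_right
  refine ge_of_tendsto h2 ?_
  filter_upwards [h, self_mem_nhdsWithin] with s hs hs0
  have hs0' : (0 : ℝ) < s := hs0
  simp only [zero_add, zero_smul, add_zero, h0, sub_zero, smul_eq_mul]
  exact mul_nonneg (inv_nonneg.2 hs0'.le) hs

/-- **One-sided comparison of derivatives.** If `g₁ u = g₂ u` and `g₂ ≤ g₁` along `u + s • v`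
for small `s > 0`, then `Dg₂(u) v ≤ Dg₁(u) v`. [folklore] -/
theorem hasFDerivAt_le_of_eventually_le {g₁ g₂ : E → ℝ} {g₁' g₂' : E →L[ℝ] ℝ} {u v : E}
    (h₁ : HasFDerivAt g₁ g₁' u) (h₂ : HasFDerivAt g₂ g₂' u) (h0 : g₁ u = g₂ u)
    (h : ∀ᶠ s in 𝓝[>] (0 : ℝ), g₂ (u + s • v) ≤ g₁ (u + s • v)) : g₂' v ≤ g₁' v := by
  have := hasFDerivAt_nonneg_of_eventually_nonneg (v := v) (h₁.sub h₂) (by simp [h0])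
    (by filter_upwards [h] with s hs; simpa using hs)
  simpa using this

/-- **The differential of a map with a differentiable left inverse is injective.** [folklore] -/
theorem hasFDerivAt_injective_of_eventually_leftInverse {τ : E → F} {σ : F → E}
    {τ' : E →L[ℝ] F} {σ' : F →L[ℝ] E} {u : E} (hτ : HasFDerivAt τ τ' u)
    (hσ : HasFDerivAt σ σ' (τ u)) (h : ∀ᶠ y in 𝓝 u, σ (τ y) = y) : Injective τ' := by
  have h1 : HasFDerivAt (σ ∘ τ) (σ'.comp τ') u := hσ.comp u hτ
  have h2 : HasFDerivAt (σ ∘ τ) (ContinuousLinearMap.id ℝ E) u :=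
    (hasFDerivAt_id u).congr_of_eventuallyEq (by filter_upwards [h] with y hy; exact hy)
  have h3 : σ'.comp τ' = ContinuousLinearMap.id ℝ E := h1.unique h2
  intro a b hab
  have := congrArg σ' hab
  rw [← ContinuousLinearMap.comp_apply, ← ContinuousLinearMap.comp_apply, h3] at this
  simpa using this

end LineCalculus

/-! ### Notation -/

/-- Local notation for the model space `ℝⁿ`. -/
local notation "𝔼 " n:arg => EuclideanSpace ℝ (Fin n)
/-- Local notation for the unit sphere `𝕊ⁿ ⊆ ℝⁿ⁺¹`. -/
local notation "𝕊 " n:arg => (Metric.sphere (0 : EuclideanSpace ℝ (Fin (n + 1))) 1)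
/-- Local notation for the closed unit ball `𝔻ⁿ ⊆ ℝⁿ`. -/
local notation "𝔻 " n:arg => (Metric.closedBall (0 : EuclideanSpace ℝ (Fin n)) 1)

/-! ### The hyperplane projection in the model -/

section Flatten

variable {n : ℕ}

/-- The first coordinate of `ℝⁿ⁺¹` as a continuous linear form. [folklore] -/
abbrev crd (n : ℕ) : (𝔼 (n + 1)) →L[ℝ] ℝ := EuclideanSpace.proj (0 : Fin (n + 1))

/-- `crd n u = u 0` (definitional). [folklore] -/
@[simp] theorem crd_apply (u : 𝔼 (n + 1)) : crd n u = u 0 := rfl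

/-- The base vector `e₀` has first coordinate `1`. [folklore] -/
@[simp] theorem closedBallBaseVector_apply_zero : (closedBallBaseVector n) 0 = 1 := by
  simp [closedBallBaseVector]

/-- **Projection onto the hyperplane `{u 0 = 0}`** along `e₀`: `u ↦ u - (u 0) • e₀`. [folklore] -/
def flatten (u : 𝔼 (n + 1)) : 𝔼 (n + 1) := u - (u 0) • closedBallBaseVector n

/-- The projection lands in the hyperplane. [folklore] -/
@[simp] theorem flatten_apply_zero (u : 𝔼 (n + 1)) : (flatten u) 0 = 0 := by
  simp [flatten]

/-- The projection fixes the hyperplane. [folklore] -/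
theorem flatten_of_apply_zero {u : 𝔼 (n + 1)} (h : u 0 = 0) : flatten u = u := by
  simp [flatten, h]

/-- Decomposition `u = (u 0) • e₀ + flatten u`. [folklore] -/
theorem smul_add_flatten (u : 𝔼 (n + 1)) : (u 0) • closedBallBaseVector n + flatten u = u := by
  simp [flatten]

/-- The projection is `C^∞` (it is affine-linear). [folklore] -/
theorem contDiff_flatten : ContDiff ℝ ∞ (flatten : (𝔼 (n + 1)) → 𝔼 (n + 1)) :=
  contDiff_id.sub ((crd n).contDiff.smul contDiff_const)

/-- The projection is translation-equivariant along the hyperplane. [folklore] -/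
theorem flatten_sub {u c : 𝔼 (n + 1)} (hc : c 0 = 0) : flatten u - c = flatten (u - c) := by
  simp only [flatten, PiLp.sub_apply, hc, sub_zero]
  abel

/-- The projection does not increase the norm (Pythagoras). [folklore] -/
theorem norm_flatten_le (u : 𝔼 (n + 1)) : ‖flatten u‖ ≤ ‖u‖ := by
  have horth : ⟪(u 0) • closedBallBaseVector n, flatten u⟫ = 0 := by
    rw [real_inner_smul_left, closedBallBaseVector, EuclideanSpace.inner_single_left]
    simp
  have h := norm_add_sq_eq_norm_sq_add_norm_sq_of_inner_eq_zero _ _ horth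
  rw [smul_add_flatten] at h
  nlinarith [norm_nonneg (flatten u), norm_nonneg u, norm_nonneg ((u 0) • closedBallBaseVector n)]

/-- The projection maps balls centred on the hyperplane into themselves. [folklore] -/
theorem flatten_mem_ball {u c : 𝔼 (n + 1)} {r : ℝ} (hc : c 0 = 0) (hu : u ∈ ball c r) :
    flatten u ∈ ball c r := by
  rw [mem_ball, dist_eq_norm] at hu ⊢
  rw [flatten_sub hc]
  exact (norm_flatten_le _).trans_lt hu

end Flatten

/-! ### The seam and the partition of unity -/

section Seam

variable {n : ℕ} {φ : (𝕊 n) ≃ₘ⟮𝓡 n, 𝓡 n⟯ (𝕊 n)} {P : Type*} [TopologicalSpace P]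
  [ChartedSpace (𝔼 (n + 1)) P]

namespace BallGluingData

variable (G : BallGluingData n φ P)

/-- **The seam** `jA (𝕊ⁿ) = jB (𝕊ⁿ)` of the gluing. [folklore] -/
def seam : Set P := range fun w : 𝕊 n => G.jA (sphereToBall n w)

/-- Membership in the seam. [folklore] -/
theorem mem_seam_iff {p : P} : p ∈ G.seam ↔ ∃ w : 𝕊 n, G.jA (sphereToBall n w) = p := Iff.rfl

/-- Seam points, first-disc form. [folklore] -/
theorem jA_sphereToBall_mem_seam (w : 𝕊 n) : G.jA (sphereToBall n w) ∈ G.seam := ⟨w, rfl⟩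

/-- Seam points, second-disc form. [folklore] -/
theorem jB_sphereToBall_mem_seam (w : 𝕊 n) : G.jB (sphereToBall n w) ∈ G.seam :=
  ⟨φ.symm w, (G.jB_sphereToBall w).symm⟩

/-- The seam is compact. [folklore] -/
theorem isCompact_seam : IsCompact G.seam :=
  isCompact_range (G.continuous_jA.comp (continuous_inclusion _))

/-- The seam is closed (Hausdorff `P`). [folklore] -/
theorem isClosed_seam [T2Space P] : IsClosed G.seam := G.isCompact_seam.isClosed

/-- Seam points are on the first disc. [folklore] -/
theorem seam_subset_range_jA : G.seam ⊆ range G.jA := by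
  rintro _ ⟨w, rfl⟩; exact ⟨_, rfl⟩

/-- Seam points are on the second disc. [folklore] -/
theorem seam_subset_range_jB : G.seam ⊆ range G.jB := by
  rintro _ ⟨w, rfl⟩; exact ⟨_, (G.jA_sphereToBall w).symm⟩

/-- The seam of the swapped data is the same. [folklore] -/
theorem symm_seam : G.symm.seam = G.seam := by
  ext p
  simp only [mem_seam_iff, symm_jA]
  constructor
  · rintro ⟨w, rfl⟩
    exact ⟨φ.symm w, (G.jB_sphereToBall w).symm⟩
  · rintro ⟨w, rfl⟩
    exact ⟨φ w, (G.jA_sphereToBall w).symm⟩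

variable [IsManifold (𝓡 (n + 1)) ∞ P]

/-- The adapted charts cover the seam. [folklore] -/
theorem seam_subset_iUnion : G.seam ⊆ ⋃ w : 𝕊 n, (G.seamChart w).chart.source := by
  rintro _ ⟨w, rfl⟩
  exact mem_iUnion.2 ⟨w, (G.seamChart w).mem_source⟩

/-- `chart_w⁻¹ (center_w) = jA w`. [folklore] -/
theorem symm_center (w : 𝕊 n) :
    (G.seamChart w).chart.symm (G.seamChart w).center = G.jA (sphereToBall n w) := by
  rw [← (G.seamChart w).apply_seamPoint, (G.seamChart w).chart.left_inv (G.seamChart w).mem_source]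

/-- Smoothness in charts: a map `C^∞` at `chart⁻¹ u` is, composed with `chart⁻¹`, `C^∞` at `u`
as a map of `ℝⁿ⁺¹`. [folklore] -/
theorem contDiffAt_comp_symm {F' : Type*} [NormedAddCommGroup F'] [NormedSpace ℝ F']
    {w : 𝕊 n} {g : P → F'} {u : 𝔼 (n + 1)} (hu : u ∈ ball (G.seamChart w).center (G.seamChart w).radius)
    (hg : ContMDiffAt (𝓡 (n + 1)) 𝓘(ℝ, F') ∞ g ((G.seamChart w).chart.symm u)) :
    ContDiffAt ℝ ∞ (g ∘ (G.seamChart w).chart.symm) u :=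
  contMDiffAt_iff_contDiffAt.1 (hg.comp u ((G.seamChart w).contMDiffAt_symm hu))

/-- **The tangential left inverse of the fold-out map**: `u ↦ chart_w (jB (φ (u / ‖u‖)))`.
[folklore] -/
def foldLeftInv (w : 𝕊 n) (x : 𝔼 (n + 1)) : 𝔼 (n + 1) :=
  (G.seamChart w).chart (G.jB (sphereToBall n (φ (radialProjection (sphereBasePoint n) x))))

/-- The tangential left inverse is `C^∞` at `w` (as a map of `ℝⁿ⁺¹`). [folklore] -/
theorem contDiffAt_foldLeftInv (w : 𝕊 n) : ContDiffAt ℝ ∞ (G.foldLeftInv w) (w : 𝔼 (n + 1)) := by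
  have h1 : ContMDiffAt 𝓘(ℝ, 𝔼 (n + 1)) (𝓡 (n + 1)) ∞
      (fun x => G.jB (sphereToBall n (φ (radialProjection (sphereBasePoint n) x)))) (w : 𝔼 (n + 1)) :=
    G.contMDiff_jB.contMDiffAt.comp _ (contMDiff_sphereToBall.contMDiffAt.comp _
      (φ.contMDiff.contMDiffAt.comp _
        (contMDiffAt_radialProjection _ (ne_zero_of_mem_unit_sphere w))))
  have h2 : G.jB (sphereToBall n (φ (radialProjection (sphereBasePoint n) (w : 𝔼 (n + 1))))) ∈
      (G.seamChart w).chart.source := by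
    rw [radialProjection_coe_sphere, ← G.jA_sphereToBall]
    exact (G.seamChart w).mem_source
  have h3 : ContMDiffAt 𝓘(ℝ, 𝔼 (n + 1)) 𝓘(ℝ, 𝔼 (n + 1)) ∞
      ((G.seamChart w).chart ∘
        fun x => G.jB (sphereToBall n (φ (radialProjection (sphereBasePoint n) x)))) (w : 𝔼 (n + 1)) :=
    ((G.seamChart w).contMDiffAt_chart h2).comp (w : 𝔼 (n + 1)) h1
  exact contMDiffAt_iff_contDiffAt.1 h3

/-! ### The local height and retraction -/

/-- The **local height** at `w`: the first coordinate of the adapted chart at `w`. [folklore] -/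
def heightLoc (w : 𝕊 n) (p : P) : ℝ := (G.seamChart w).chart p 0

/-- The **local retraction** at `w`, read through `jB⁻¹`: project to the seam hyperplane in the
adapted chart, come back to `P` (a seam point) and take its second-disc label in `ℝⁿ⁺¹`.
[folklore] -/
def retrLoc (w : 𝕊 n) (p : P) : 𝔼 (n + 1) :=
  ((G.invB ((G.seamChart w).chart.symm (flatten ((G.seamChart w).chart p))) : 𝔻 (n + 1)) :
    𝔼 (n + 1))

variable {G}

/-- The local height is `C^∞` on the source of the adapted chart. [folklore] -/
theorem contMDiffOn_heightLoc (w : 𝕊 n) :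
    ContMDiffOn (𝓡 (n + 1)) 𝓘(ℝ) ∞ (G.heightLoc w) (G.seamChart w).chart.source :=
  (crd n).contMDiff.comp_contMDiffOn (G.seamChart w).contMDiffOn_chart

/-- The local height vanishes exactly on the seam. [folklore] -/
theorem heightLoc_eq_zero_iff {w : 𝕊 n} {p : P} (hp : p ∈ (G.seamChart w).chart.source) :
    G.heightLoc w p = 0 ↔ p ∈ G.seam :=
  (G.seamChart w).eq_zero_iff hp

/-- The local height is nonnegative exactly on the second disc. [folklore] -/
theorem heightLoc_nonneg_iff {w : 𝕊 n} {p : P} (hp : p ∈ (G.seamChart w).chart.source) :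
    0 ≤ G.heightLoc w p ↔ p ∈ range G.jB :=
  (G.seamChart w).nonneg_iff p hp

/-- The local height is nonpositive exactly on the first disc. [folklore] -/
theorem heightLoc_nonpos_iff {w : 𝕊 n} {p : P} (hp : p ∈ (G.seamChart w).chart.source) :
    G.heightLoc w p ≤ 0 ↔ p ∈ range G.jA :=
  (G.seamChart w).nonpos_iff p hp

/-- The local height is negative exactly on the interior of the first disc. [folklore] -/
theorem heightLoc_neg_iff {w : 𝕊 n} {p : P} (hp : p ∈ (G.seamChart w).chart.source) :
    G.heightLoc w p < 0 ↔ ∃ a : 𝔻 (n + 1), ‖(a : 𝔼 (n + 1))‖ < 1 ∧ G.jA a = p :=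
  (G.seamChart w).neg_iff hp

/-- The local height is positive exactly on the interior of the second disc. [folklore] -/
theorem heightLoc_pos_iff {w : 𝕊 n} {p : P} (hp : p ∈ (G.seamChart w).chart.source) :
    0 < G.heightLoc w p ↔ ∃ b : 𝔻 (n + 1), ‖(b : 𝔼 (n + 1))‖ < 1 ∧ G.jB b = p :=
  (G.seamChart w).pos_iff hp

/-- The point of `P` under the local retraction is a seam point. [folklore] -/
theorem exists_symm_flatten_eq {w : 𝕊 n} {p : P} (hp : p ∈ (G.seamChart w).chart.source) :
    ∃ w' : 𝕊 n, G.jA (sphereToBall n w') =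
      (G.seamChart w).chart.symm (flatten ((G.seamChart w).chart p)) :=
  (G.seamChart w).exists_eq_symm_of_eq_zero
    (flatten_mem_ball (G.seamChart w).center_zero ((G.seamChart w).map_source hp))
    (flatten_apply_zero _)

/-- The local retraction of a seam point `jA w'` in the chart at `w` is `φ w'`. [folklore] -/
theorem retrLoc_jA_sphereToBall {w w' : 𝕊 n}
    (hp : G.jA (sphereToBall n w') ∈ (G.seamChart w).chart.source) :
    G.retrLoc w (G.jA (sphereToBall n w')) = (φ w' : 𝔼 (n + 1)) := by
  have h0 : (G.seamChart w).chart (G.jA (sphereToBall n w')) 0 = 0 :=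
    ((G.seamChart w).eq_zero_iff hp).2 ⟨w', rfl⟩
  rw [retrLoc, flatten_of_apply_zero h0, (G.seamChart w).chart.left_inv hp, G.jA_sphereToBall,
    G.invB_jB]

/-- The local retraction takes values on the unit sphere. [folklore] -/
theorem norm_retrLoc {w : 𝕊 n} {p : P} (hp : p ∈ (G.seamChart w).chart.source) :
    ‖G.retrLoc w p‖ = 1 := by
  obtain ⟨w', hw'⟩ := exists_symm_flatten_eq hp
  rw [retrLoc, ← hw', G.jA_sphereToBall, G.invB_jB]
  simp

/-- The local retraction is `C^∞` on the source of the adapted chart: it is the composite of the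
chart, the hyperplane projection (into the closed upper half ball) and `jB⁻¹ ∘ chart⁻¹`, which
is `C^∞` on the closed upper half ball. [folklore] -/
theorem contMDiffOn_retrLoc (w : 𝕊 n) :
    ContMDiffOn (𝓡 (n + 1)) 𝓘(ℝ, 𝔼 (n + 1)) ∞ (G.retrLoc w) (G.seamChart w).chart.source := by
  set S := G.seamChart w
  have h1 : ContDiffOn ℝ ∞
      (fun u => ((G.invB (S.chart.symm (flatten u)) : 𝔻 (n + 1)) : 𝔼 (n + 1)))
      (ball S.center S.radius) :=
    S.contDiffOn_invB.comp contDiff_flatten.contDiffOn fun u hu =>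
      ⟨flatten_mem_ball S.center_zero hu, by simp⟩
  have h2 : ContMDiffOn 𝓘(ℝ, 𝔼 (n + 1)) 𝓘(ℝ, 𝔼 (n + 1)) ∞
      (fun u => ((G.invB (S.chart.symm (flatten u)) : 𝔻 (n + 1)) : 𝔼 (n + 1)))
      (ball S.center S.radius) := contMDiffOn_iff_contDiffOn.2 h1
  exact h2.comp S.contMDiffOn_chart fun p hp => S.map_source hp

/-! #### The normal derivative of one local height is positive -/

section OneTerm

variable {w w₁ : 𝕊 n} (hw₁ : G.jA (sphereToBall n w) ∈ (G.seamChart w₁).chart.source)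

/-- The local height at `w₁` read in the chart at `w`: the first coordinate of the transition map
`chart_{w₁} ∘ chart_w⁻¹`. [folklore] -/
def heightLocChart (w w₁ : 𝕊 n) : (𝔼 (n + 1)) → ℝ := G.heightLoc w₁ ∘ (G.seamChart w).chart.symm

/-- The transition map `chart_{w₁} ∘ chart_w⁻¹`. [folklore] -/
def transition (w w₁ : 𝕊 n) : (𝔼 (n + 1)) → 𝔼 (n + 1) :=
  (G.seamChart w₁).chart ∘ (G.seamChart w).chart.symm

/-- The inverse transition map `chart_w ∘ chart_{w₁}⁻¹`. [folklore] -/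
def transitionInv (w w₁ : 𝕊 n) : (𝔼 (n + 1)) → 𝔼 (n + 1) :=
  (G.seamChart w).chart ∘ (G.seamChart w₁).chart.symm

/-- `heightLocChart = crd ∘ transition`. [folklore] -/
theorem heightLocChart_eq (w w₁ : 𝕊 n) :
    G.heightLocChart w w₁ = crd n ∘ G.transition w w₁ := rfl

include hw₁ in
/-- Near the centre of the chart at `w`, `chart_w⁻¹` lands in the source of the chart at `w₁`.
[folklore] -/
theorem eventually_symm_mem_source :
    ∀ᶠ u in 𝓝 (G.seamChart w).center, u ∈ ball (G.seamChart w).center (G.seamChart w).radius ∧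
      (G.seamChart w).chart.symm u ∈ (G.seamChart w₁).chart.source := by
  set S := G.seamChart w
  have h1 : ∀ᶠ u in 𝓝 S.center, u ∈ ball S.center S.radius :=
    isOpen_ball.mem_nhds (mem_ball_self S.radius_pos)
  have hc : ContinuousAt S.chart.symm S.center :=
    S.chart.continuousAt_symm S.center_mem_target
  have h2 : ∀ᶠ u in 𝓝 S.center, S.chart.symm u ∈ (G.seamChart w₁).chart.source := by
    apply hc.preimage_mem_nhds
    rw [symm_center]
    exact (G.seamChart w₁).isOpen_source.mem_nhds hw₁
  exact h1.and h2

include hw₁ in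
/-- Along any line through the centre, for small parameters we stay in the target ball and
`chart_w⁻¹` lands in the source of the chart at `w₁`. [folklore] -/
theorem eventually_lineMap_mem_source (v : 𝔼 (n + 1)) :
    ∀ᶠ s in 𝓝 (0 : ℝ), (G.seamChart w).center + s • v ∈
        ball (G.seamChart w).center (G.seamChart w).radius ∧
      (G.seamChart w).chart.symm ((G.seamChart w).center + s • v) ∈
        (G.seamChart w₁).chart.source := by
  have hc : Continuous fun s : ℝ => (G.seamChart w).center + s • v := by fun_prop
  exact (hc.tendsto' 0 _ (by rw [zero_smul, add_zero])).eventually (eventually_symm_mem_source hw₁)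

include hw₁ in
/-- The transition map is `C^∞` at the centre. [folklore] -/
theorem contDiffAt_transition : ContDiffAt ℝ ∞ (G.transition w w₁) (G.seamChart w).center :=
  G.contDiffAt_comp_symm (mem_ball_self (G.seamChart w).radius_pos)
    (by rw [symm_center]; exact (G.seamChart w₁).contMDiffAt_chart hw₁)

include hw₁ in
/-- The inverse transition map is `C^∞` at the image of the centre. [folklore] -/
theorem contDiffAt_transitionInv :
    ContDiffAt ℝ ∞ (G.transitionInv w w₁) (G.transition w w₁ (G.seamChart w).center) := by
  have hq : G.transition w w₁ (G.seamChart w).center = (G.seamChart w₁).chart (G.jA (sphereToBall n w)) := by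
    rw [transition, comp_apply, symm_center]
  have hq' : G.transition w w₁ (G.seamChart w).center ∈
      ball (G.seamChart w₁).center (G.seamChart w₁).radius := by
    rw [hq]; exact (G.seamChart w₁).map_source hw₁
  have h1 : ContMDiffAt (𝓡 (n + 1)) 𝓘(ℝ, 𝔼 (n + 1)) ∞ (G.seamChart w).chart
      ((G.seamChart w₁).chart.symm (G.transition w w₁ (G.seamChart w).center)) := by
    rw [hq, (G.seamChart w₁).chart.left_inv hw₁]
    exact (G.seamChart w).contMDiffAt_chart (G.seamChart w).mem_source
  exact contMDiffAt_iff_contDiffAt.1 (h1.comp _ ((G.seamChart w₁).contMDiffAt_symm hq'))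

include hw₁ in
/-- `transitionInv ∘ transition = id` near the centre. [folklore] -/
theorem eventually_transitionInv_transition :
    ∀ᶠ u in 𝓝 (G.seamChart w).center, G.transitionInv w w₁ (G.transition w w₁ u) = u := by
  filter_upwards [eventually_symm_mem_source hw₁] with u hu
  rw [transitionInv, transition, comp_apply, comp_apply, (G.seamChart w₁).chart.left_inv hu.2,
    (G.seamChart w).apply_symm hu.1]

include hw₁ in
/-- **The differential of the transition map at the centre is surjective.** [folklore] -/
theorem surjective_fderiv_transition :
    Surjective (fderiv ℝ (G.transition w w₁) (G.seamChart w).center) := by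
  have hτ : HasFDerivAt (G.transition w w₁) (fderiv ℝ (G.transition w w₁) (G.seamChart w).center)
      (G.seamChart w).center :=
    ((contDiffAt_transition hw₁).differentiableAt (by simp)).hasFDerivAt
  have hσ : HasFDerivAt (G.transitionInv w w₁)
      (fderiv ℝ (G.transitionInv w w₁) (G.transition w w₁ (G.seamChart w).center))
      (G.transition w w₁ (G.seamChart w).center) :=
    ((contDiffAt_transitionInv hw₁).differentiableAt (by simp)).hasFDerivAt
  have hinj := hasFDerivAt_injective_of_eventually_leftInverse hτ hσ
    (eventually_transitionInv_transition hw₁)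
  exact (LinearMap.injective_iff_surjective
    (f := ((fderiv ℝ (G.transition w w₁) (G.seamChart w).center : (𝔼 (n + 1)) →L[ℝ] 𝔼 (n + 1)) :
      (𝔼 (n + 1)) →ₗ[ℝ] 𝔼 (n + 1)))).1 hinj

include hw₁ in
/-- The local height in the chart is `C^∞` at the centre. [folklore] -/
theorem contDiffAt_heightLocChart : ContDiffAt ℝ ∞ (G.heightLocChart w w₁) (G.seamChart w).center := by
  rw [heightLocChart_eq]
  exact (crd n).contDiff.contDiffAt.comp _ (contDiffAt_transition hw₁)

include hw₁ in
/-- The local height in the chart vanishes at the centre. [folklore] -/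
theorem heightLocChart_center : G.heightLocChart w w₁ (G.seamChart w).center = 0 := by
  rw [heightLocChart, comp_apply, symm_center]
  exact (heightLoc_eq_zero_iff hw₁).2 (G.jA_sphereToBall_mem_seam w)

include hw₁ in
/-- **The tangential derivatives of the local height vanish** (the transition map preserves the
seam hyperplane). [folklore] -/
theorem fderiv_heightLocChart_apply_of_apply_zero {v : 𝔼 (n + 1)} (hv : v 0 = 0) :
    fderiv ℝ (G.heightLocChart w w₁) (G.seamChart w).center v = 0 := by
  set S := G.seamChart w
  have hd : HasFDerivAt (G.heightLocChart w w₁) (fderiv ℝ (G.heightLocChart w w₁) S.center) S.center :=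
    ((contDiffAt_heightLocChart hw₁).differentiableAt (by simp)).hasFDerivAt
  refine hasFDerivAt_apply_eq_zero_of_eventually_const hd ?_
  filter_upwards [eventually_lineMap_mem_source hw₁ v] with s hs
  obtain ⟨hs1, hs2⟩ := hs
  have h0 : (S.center + s • v) 0 = 0 := by simp [S.center_zero, hv]
  obtain ⟨w', hw'⟩ := S.exists_eq_symm_of_eq_zero hs1 h0
  rw [heightLocChart_center hw₁, heightLocChart, comp_apply, ← hw']
  rw [← hw'] at hs2
  exact (heightLoc_eq_zero_iff hs2).2 (G.jA_sphereToBall_mem_seam w')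

include hw₁ in
/-- **The normal derivative of the local height is nonnegative** (the local height is `≥ 0` on
the upper half ball, where `chart_w⁻¹` lands in the second disc). [folklore] -/
theorem fderiv_heightLocChart_baseVector_nonneg :
    0 ≤ fderiv ℝ (G.heightLocChart w w₁) (G.seamChart w).center (closedBallBaseVector n) := by
  set S := G.seamChart w
  have hd : HasFDerivAt (G.heightLocChart w w₁) (fderiv ℝ (G.heightLocChart w w₁) S.center) S.center :=
    ((contDiffAt_heightLocChart hw₁).differentiableAt (by simp)).hasFDerivAt
  refine hasFDerivAt_nonneg_of_eventually_nonneg hd (heightLocChart_center hw₁) ?_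
  filter_upwards [mem_nhdsWithin_of_mem_nhds (eventually_lineMap_mem_source hw₁
    (closedBallBaseVector n)), self_mem_nhdsWithin] with s hs hs0
  obtain ⟨hs1, hs2⟩ := hs
  have hs0' : (0 : ℝ) < s := hs0
  have h0 : 0 ≤ (S.center + s • closedBallBaseVector n) 0 := by simp [S.center_zero, hs0'.le]
  rw [heightLocChart, comp_apply]
  exact (heightLoc_nonneg_iff hs2).2 (S.symm_mem_range_jB hs1 h0)

include hw₁ in
/-- **The normal derivative of the local height is positive**: it is nonnegative, and nonzero
because the (surjective) differential of the transition map would otherwise take values in the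
hyperplane. [folklore] -/
theorem fderiv_heightLocChart_baseVector_pos :
    0 < fderiv ℝ (G.heightLocChart w w₁) (G.seamChart w).center (closedBallBaseVector n) := by
  refine lt_of_le_of_ne (fderiv_heightLocChart_baseVector_nonneg hw₁) fun h0 => ?_
  set S := G.seamChart w
  set T := fderiv ℝ (G.transition w w₁) S.center with hT
  have hdiff : DifferentiableAt ℝ (G.transition w w₁) S.center :=
    (contDiffAt_transition hw₁).differentiableAt (by simp)
  -- the differential of the local height is `crd ∘ T`
  have hcomp : fderiv ℝ (G.heightLocChart w w₁) S.center = (crd n).comp T := by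
    rw [heightLocChart_eq, hT, fderiv_comp _ (crd n).differentiableAt hdiff,
      ContinuousLinearMap.fderiv]
  -- `crd ∘ T = 0`
  have hzero : ∀ v : 𝔼 (n + 1), (T v) 0 = 0 := by
    intro v
    have htan : (crd n).comp T (flatten v) = 0 := by
      rw [← hcomp]
      exact fderiv_heightLocChart_apply_of_apply_zero hw₁ (flatten_apply_zero v)
    have hnor : (crd n).comp T (closedBallBaseVector n) = 0 := by
      rw [← hcomp]; exact h0.symm
    have : T v = (v 0) • T (closedBallBaseVector n) + T (flatten v) := by
      conv_lhs => rw [← smul_add_flatten v]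
      rw [map_add, map_smul]
    rw [this]
    simp only [ContinuousLinearMap.comp_apply, crd_apply] at htan hnor
    simp [htan, hnor]
  -- contradiction with surjectivity
  obtain ⟨v, hv⟩ := surjective_fderiv_transition hw₁ (closedBallBaseVector n)
  have := hzero v
  rw [← hT] at hv
  rw [hv, closedBallBaseVector_apply_zero] at this
  exact one_ne_zero this

end OneTerm

variable (G) [T2Space P]

/-- **A smooth partition of unity on `P` subordinate to the adapted charts of the seam**
(existence; `P` is compact Hausdorff). [folklore] -/
theorem exists_seamPOU : ∃ ρ : SmoothPartitionOfUnity (𝕊 n) (𝓡 (n + 1)) P G.seam,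
    ρ.IsSubordinate fun w => (G.seamChart w).chart.source := by
  haveI := G.compactSpace
  exact SmoothPartitionOfUnity.exists_isSubordinate (𝓡 (n + 1)) G.isClosed_seam _
    (fun w => (G.seamChart w).isOpen_source) G.seam_subset_iUnion

/-- A chosen smooth partition of unity subordinate to the adapted charts. [folklore] -/
def seamPOU : SmoothPartitionOfUnity (𝕊 n) (𝓡 (n + 1)) P G.seam := G.exists_seamPOU.choose

/-- The chosen partition of unity is subordinate to the adapted charts. [folklore] -/
theorem seamPOU_isSubordinate :
    G.seamPOU.IsSubordinate fun w => (G.seamChart w).chart.source :=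
  G.exists_seamPOU.choose_spec

/-- Where `ρ_w ≠ 0` we are in the source of the adapted chart at `w`. [folklore] -/
theorem mem_source_of_seamPOU_ne_zero {w : 𝕊 n} {p : P} (h : G.seamPOU w p ≠ 0) :
    p ∈ (G.seamChart w).chart.source :=
  G.seamPOU_isSubordinate w (subset_tsupport _ h)

/-! ### The global height and retraction -/

/-- **The height function** of the gluing: `height p = Σ_w ρ_w p · (chart_w p) 0`. [folklore] -/
def height (p : P) : ℝ := ∑ᶠ w : 𝕊 n, G.seamPOU w p • G.heightLoc w p

/-- **The retraction vector** of the gluing: `retrVec p = Σ_w ρ_w p • retrLoc_w p`. [folklore] -/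
def retrVec (p : P) : 𝔼 (n + 1) := ∑ᶠ w : 𝕊 n, G.seamPOU w p • G.retrLoc w p

/-- The height function is `C^∞` on `P`. [folklore] -/
theorem contMDiff_height : ContMDiff (𝓡 (n + 1)) 𝓘(ℝ) ∞ G.height :=
  G.seamPOU_isSubordinate.contMDiff_finsum_smul (fun w => (G.seamChart w).isOpen_source)
    fun w => contMDiffOn_heightLoc w

/-- The retraction vector is `C^∞` on `P`. [folklore] -/
theorem contMDiff_retrVec : ContMDiff (𝓡 (n + 1)) 𝓘(ℝ, 𝔼 (n + 1)) ∞ G.retrVec :=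
  G.seamPOU_isSubordinate.contMDiff_finsum_smul (fun w => (G.seamChart w).isOpen_source)
    fun w => contMDiffOn_retrLoc w

/-- The height function is continuous. [folklore] -/
theorem continuous_height : Continuous G.height := G.contMDiff_height.continuous

/-- The retraction vector is continuous. [folklore] -/
theorem continuous_retrVec : Continuous G.retrVec := G.contMDiff_retrVec.continuous

variable {G}

/-- The height vanishes on the seam. [folklore] -/
theorem height_eq_zero_of_mem_seam {p : P} (hp : p ∈ G.seam) : G.height p = 0 := by
  apply finsum_eq_zero_of_forall_eq_zero
  intro w
  by_cases h : G.seamPOU w p = 0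
  · rw [h, zero_smul]
  · rw [(heightLoc_eq_zero_iff (G.mem_source_of_seamPOU_ne_zero h)).2 hp, smul_zero]

/-- **On the seam the retraction vector is the second-disc label**: `retrVec (jA w') = φ w'`.
[folklore] -/
theorem retrVec_jA_sphereToBall (w' : 𝕊 n) :
    G.retrVec (G.jA (sphereToBall n w')) = (φ w' : 𝔼 (n + 1)) := by
  set p := G.jA (sphereToBall n w')
  have h1 : (fun w => G.seamPOU w p • G.retrLoc w p) = fun w => G.seamPOU w p • (φ w' : 𝔼 (n + 1)) := by
    funext w
    by_cases h : G.seamPOU w p = 0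
    · rw [h, zero_smul, zero_smul]
    · rw [retrLoc_jA_sphereToBall (G.mem_source_of_seamPOU_ne_zero h)]
  rw [retrVec, h1, ← finsum_smul, G.seamPOU.sum_eq_one (G.jA_sphereToBall_mem_seam w'), one_smul]

/-- The height is nonpositive on the first disc. [folklore] -/
theorem height_nonpos {p : P} (hp : p ∈ range G.jA) : G.height p ≤ 0 := by
  have : 0 ≤ ∑ᶠ w : 𝕊 n, -(G.seamPOU w p • G.heightLoc w p) := by
    apply finsum_nonneg
    intro w
    by_cases h : G.seamPOU w p = 0
    · simp [h]
    · rw [neg_nonneg, smul_eq_mul]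
      exact mul_nonpos_of_nonneg_of_nonpos (G.seamPOU.nonneg w p)
        ((heightLoc_nonpos_iff (G.mem_source_of_seamPOU_ne_zero h)).2 hp)
  rw [finsum_neg_distrib] at this
  exact neg_nonneg.1 this

/-- The height is nonnegative on the second disc. [folklore] -/
theorem height_nonneg {p : P} (hp : p ∈ range G.jB) : 0 ≤ G.height p := by
  apply finsum_nonneg
  intro w
  by_cases h : G.seamPOU w p = 0
  · simp [h]
  · rw [smul_eq_mul]
    exact mul_nonneg (G.seamPOU.nonneg w p)
      ((heightLoc_nonneg_iff (G.mem_source_of_seamPOU_ne_zero h)).2 hp)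

/-- Families weighted by the partition of unity have finite support at each point. [folklore] -/
theorem finite_support_smul (p : P) (g : (𝕊 n) → ℝ) :
    (Function.support fun w : 𝕊 n => G.seamPOU w p • g w).Finite := by
  refine (G.seamPOU.locallyFinite.point_finite p).subset ?_
  intro w hw
  simp only [Function.mem_support, ne_eq, smul_eq_mul, mul_eq_zero, not_or] at hw
  exact hw.1

/-- The summands of the height have finite support at each point. [folklore] -/
theorem hasFiniteSupport_height (p : P) :
    (Function.support fun w : 𝕊 n => G.seamPOU w p • G.heightLoc w p).Finite :=
  finite_support_smul p fun w => G.heightLoc w p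

/-- A single summand of the height is dominated by the height on the second disc. [folklore] -/
theorem smul_heightLoc_le_height {p : P} (hp : p ∈ range G.jB) (w : 𝕊 n) :
    G.seamPOU w p • G.heightLoc w p ≤ G.height p := by
  refine single_le_finsum (f := fun w' => G.seamPOU w' p • G.heightLoc w' p) w
    (hasFiniteSupport_height p) fun w' => ?_
  by_cases h : G.seamPOU w' p = 0
  · simp [h]
  · rw [smul_eq_mul]
    exact mul_nonneg (G.seamPOU.nonneg w' p)
      ((heightLoc_nonneg_iff (G.mem_source_of_seamPOU_ne_zero h)).2 hp)

/-- **The height is negative on the interior of the first disc** wherever the partition of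
unity is positive. [folklore] -/
theorem height_neg {p : P} {a : 𝔻 (n + 1)} (ha : ‖(a : 𝔼 (n + 1))‖ < 1) (hp : G.jA a = p)
    (hpos : 0 < ∑ᶠ w : 𝕊 n, G.seamPOU w p) : G.height p < 0 := by
  obtain ⟨w, hw⟩ : ∃ w, G.seamPOU w p ≠ 0 := by
    by_contra h
    push Not at h
    rw [finsum_eq_zero_of_forall_eq_zero h] at hpos
    exact lt_irrefl _ hpos
  have hws := G.mem_source_of_seamPOU_ne_zero hw
  have hlt : G.seamPOU w p • G.heightLoc w p < 0 := by
    rw [smul_eq_mul]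
    exact mul_neg_of_pos_of_neg (lt_of_le_of_ne (G.seamPOU.nonneg w p) (Ne.symm hw))
      ((heightLoc_neg_iff hws).2 ⟨a, ha, hp⟩)
  -- compare `-height` with the single positive summand `ρ_w • (-h_w)`
  have hA : p ∈ range G.jA := ⟨a, hp⟩
  have hle : G.seamPOU w p • (-G.heightLoc w p) ≤
      ∑ᶠ w' : 𝕊 n, G.seamPOU w' p • (-G.heightLoc w' p) := by
    refine single_le_finsum (f := fun w' => G.seamPOU w' p • (-G.heightLoc w' p)) w
      (finite_support_smul p fun w' => -G.heightLoc w' p) fun w' => ?_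
    by_cases h : G.seamPOU w' p = 0
    · simp [h]
    · rw [smul_eq_mul]
      exact mul_nonneg (G.seamPOU.nonneg w' p)
        (neg_nonneg.2 ((heightLoc_nonpos_iff (G.mem_source_of_seamPOU_ne_zero h)).2 hA))
  have hsum : ∑ᶠ w' : 𝕊 n, G.seamPOU w' p • (-G.heightLoc w' p) = -G.height p := by
    simp only [smul_neg]
    rw [finsum_neg_distrib]
    rfl
  rw [hsum, smul_neg] at hle
  linarith

/-- **The height is positive on the interior of the second disc** wherever the partition of
unity is positive. [folklore] -/
theorem height_pos {p : P} {b : 𝔻 (n + 1)} (hb : ‖(b : 𝔼 (n + 1))‖ < 1) (hp : G.jB b = p)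
    (hpos : 0 < ∑ᶠ w : 𝕊 n, G.seamPOU w p) : 0 < G.height p := by
  obtain ⟨w, hw⟩ : ∃ w, G.seamPOU w p ≠ 0 := by
    by_contra h
    push Not at h
    rw [finsum_eq_zero_of_forall_eq_zero h] at hpos
    exact lt_irrefl _ hpos
  have hws := G.mem_source_of_seamPOU_ne_zero hw
  have hlt : 0 < G.seamPOU w p • G.heightLoc w p := by
    rw [smul_eq_mul]
    exact mul_pos (lt_of_le_of_ne (G.seamPOU.nonneg w p) (Ne.symm hw))
      ((heightLoc_pos_iff hws).2 ⟨b, hb, hp⟩)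
  exact hlt.trans_le (smul_heightLoc_le_height ⟨b, hp⟩ w)

/-- The sign of the height decides the disc: `height p < 0` forces the interior of the first
disc. [folklore] -/
theorem exists_jA_of_height_neg {p : P} (h : G.height p < 0) :
    ∃ a : 𝔻 (n + 1), ‖(a : 𝔼 (n + 1))‖ < 1 ∧ G.jA a = p := by
  by_contra hne
  have hB : p ∈ range G.jB := by
    by_contra hB
    exact hne (G.exists_norm_lt_one_of_notMem_range_jB hB)
  exact absurd h (not_lt.2 (height_nonneg hB))

/-- The sign of the height decides the disc: `0 < height p` forces the interior of the second
disc. [folklore] -/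
theorem exists_jB_of_height_pos {p : P} (h : 0 < G.height p) :
    ∃ b : 𝔻 (n + 1), ‖(b : 𝔼 (n + 1))‖ < 1 ∧ G.jB b = p := by
  by_contra hne
  have hA : p ∈ range G.jA := by
    by_contra hA
    exact hne (G.exists_norm_lt_one_of_notMem_range_jA hA)
  exact absurd h (not_lt.2 (height_nonpos hA))

/-- Where the partition of unity is positive, `height p = 0` forces the seam. [folklore] -/
theorem mem_seam_of_height_eq_zero {p : P} (h : G.height p = 0)
    (hpos : 0 < ∑ᶠ w : 𝕊 n, G.seamPOU w p) : p ∈ G.seam := by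
  rcases G.mem_range_or p with ⟨a, rfl⟩ | ⟨b, rfl⟩
  · by_cases ha : ‖(a : 𝔼 (n + 1))‖ < 1
    · exact absurd h (height_neg ha rfl hpos).ne
    · obtain ⟨w, hw⟩ := exists_sphereToBall_eq
        ((mem_closedBall_zero_iff.1 a.2).antisymm (not_lt.1 ha))
      exact ⟨w, congrArg G.jA hw⟩
  · by_cases hb : ‖(b : 𝔼 (n + 1))‖ < 1
    · exact absurd h (height_pos hb rfl hpos).ne'
    · obtain ⟨w, hw⟩ := exists_sphereToBall_eq
        ((mem_closedBall_zero_iff.1 b.2).antisymm (not_lt.1 hb))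
      rw [← hw]
      exact G.jB_sphereToBall_mem_seam w

variable (G)

/-- The open set where the partition of unity is positive; it contains the seam. [folklore] -/
def pouPos : Set P := {p | 0 < ∑ᶠ w : 𝕊 n, G.seamPOU w p}

/-- `pouPos` is open. [folklore] -/
theorem isOpen_pouPos : IsOpen G.pouPos := by
  have h : ContMDiff (𝓡 (n + 1)) 𝓘(ℝ) ∞ fun p : P => ∑ᶠ w : 𝕊 n, G.seamPOU w p :=
    G.seamPOU.contMDiff_sum
  exact isOpen_lt continuous_const h.continuous

/-- The seam lies in `pouPos`. [folklore] -/
theorem seam_subset_pouPos : G.seam ⊆ G.pouPos := fun p hp => by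
  change 0 < ∑ᶠ w : 𝕊 n, G.seamPOU w p
  rw [G.seamPOU.sum_eq_one hp]
  exact one_pos

/-! ### The fold-out map -/

/-- The **fold direction**: `φ⁻¹ (retrVec p / ‖retrVec p‖) ∈ 𝕊ⁿ` (junk where `retrVec p = 0`).
[folklore] -/
def foldDir (p : P) : 𝕊 n := φ.symm (radialProjection (sphereBasePoint n) (G.retrVec p))

/-- **The fold-out map** `P → ℝⁿ⁺¹`, `p ↦ (1 + height p) • foldDir p`: it sends the seam point
`jA z` to `z`, the first disc inside the unit ball and the second disc outside (near the seam).
[folklore] -/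
def fold (p : P) : 𝔼 (n + 1) := (1 + G.height p) • ((G.foldDir p : 𝕊 n) : 𝔼 (n + 1))

/-- The fold direction is a unit vector. [folklore] -/
@[simp] theorem norm_coe_foldDir (p : P) : ‖((G.foldDir p : 𝕊 n) : 𝔼 (n + 1))‖ = 1 :=
  norm_eq_of_mem_sphere (G.foldDir p)

/-- `‖fold p‖ = |1 + height p|`. [folklore] -/
theorem norm_fold (p : P) : ‖G.fold p‖ = |1 + G.height p| := by
  rw [fold, norm_smul, norm_coe_foldDir, mul_one, Real.norm_eq_abs]

/-- `‖fold p‖² = (1 + height p)²`. [folklore] -/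
theorem norm_fold_sq (p : P) : ‖G.fold p‖ ^ 2 = (1 + G.height p) ^ 2 := by
  rw [norm_fold, sq_abs]

/-- **The fold-out map sends the seam point `jA w` to `w`.** [folklore] -/
@[simp] theorem fold_jA_sphereToBall (w : 𝕊 n) : G.fold (G.jA (sphereToBall n w)) = w := by
  rw [fold, height_eq_zero_of_mem_seam (G.jA_sphereToBall_mem_seam w), add_zero, one_smul, foldDir,
    retrVec_jA_sphereToBall, radialProjection_coe_sphere, Diffeomorph.symm_apply_apply]

/-- The fold direction of the seam point `jA w` is `w`. [folklore] -/
@[simp] theorem foldDir_jA_sphereToBall (w : 𝕊 n) : G.foldDir (G.jA (sphereToBall n w)) = w := by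
  rw [foldDir, retrVec_jA_sphereToBall, radialProjection_coe_sphere, Diffeomorph.symm_apply_apply]

/-- The retraction vector does not vanish on the seam. [folklore] -/
theorem retrVec_ne_zero_of_mem_seam {p : P} (hp : p ∈ G.seam) : G.retrVec p ≠ 0 := by
  obtain ⟨w, rfl⟩ := hp
  rw [retrVec_jA_sphereToBall]
  exact ne_zero_of_mem_unit_sphere _

/-- The set where the retraction vector is nonzero is open. [folklore] -/
theorem isOpen_retrVec_ne_zero : IsOpen {p : P | G.retrVec p ≠ 0} :=
  isOpen_ne_fun G.continuous_retrVec continuous_const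

/-- The fold direction is `C^∞` where the retraction vector is nonzero. [folklore] -/
theorem contMDiffAt_foldDir {p : P} (hp : G.retrVec p ≠ 0) :
    ContMDiffAt (𝓡 (n + 1)) (𝓡 n) ∞ G.foldDir p :=
  φ.symm.contMDiff.contMDiffAt.comp p
    ((contMDiffAt_radialProjection _ hp).comp p G.contMDiff_retrVec.contMDiffAt)

/-- **The fold-out map is `C^∞` where the retraction vector is nonzero** (in particular near the
seam). [folklore] -/
theorem contMDiffAt_fold {p : P} (hp : G.retrVec p ≠ 0) :
    ContMDiffAt (𝓡 (n + 1)) 𝓘(ℝ, 𝔼 (n + 1)) ∞ G.fold p := by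
  have h1 : ContMDiffAt (𝓡 (n + 1)) 𝓘(ℝ, 𝔼 (n + 1)) ∞
      (fun q => ((G.foldDir q : 𝕊 n) : 𝔼 (n + 1))) p :=
    (contMDiff_coe_sphere (E := 𝔼 (n + 1)) (n := n)).contMDiffAt.comp p (G.contMDiffAt_foldDir hp)
  exact ((contMDiff_const (c := (1 : ℝ))).add G.contMDiff_height).contMDiffAt.smul h1

/-- The fold-out map is continuous at points where the retraction vector is nonzero. [folklore] -/
theorem continuousAt_fold {p : P} (hp : G.retrVec p ≠ 0) : ContinuousAt G.fold p :=
  (G.contMDiffAt_fold hp).continuousAt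

/-- The fold-out map is `C^∞` on the open set where the retraction vector is nonzero. [folklore] -/
theorem contMDiffOn_fold :
    ContMDiffOn (𝓡 (n + 1)) 𝓘(ℝ, 𝔼 (n + 1)) ∞ G.fold {p : P | G.retrVec p ≠ 0} :=
  fun _ hp => (G.contMDiffAt_fold hp).contMDiffWithinAt

/-! ### The fold-out map read in an adapted chart -/

/-- The fold-out map read in the adapted chart at `w`: `fold ∘ chart_w⁻¹ : ℝⁿ⁺¹ → ℝⁿ⁺¹`. [folklore] -/
def foldChart (w : 𝕊 n) : (𝔼 (n + 1)) → 𝔼 (n + 1) := G.fold ∘ (G.seamChart w).chart.symm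

/-- At the centre the fold-out map reads `w`. [folklore] -/
@[simp] theorem foldChart_center (w : 𝕊 n) : G.foldChart w (G.seamChart w).center = w := by
  rw [foldChart, comp_apply, symm_center, fold_jA_sphereToBall]

/-- The fold-out map in the chart is `C^∞` at points over `{retrVec ≠ 0}`. [folklore] -/
theorem contDiffAt_foldChart {w : 𝕊 n} {u : 𝔼 (n + 1)}
    (hu : u ∈ ball (G.seamChart w).center (G.seamChart w).radius)
    (hr : G.retrVec ((G.seamChart w).chart.symm u) ≠ 0) :
    ContDiffAt ℝ ∞ (G.foldChart w) u :=
  G.contDiffAt_comp_symm hu (G.contMDiffAt_fold hr)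

/-- The fold-out map in the chart is `C^∞` at the centre. [folklore] -/
theorem contDiffAt_foldChart_center (w : 𝕊 n) :
    ContDiffAt ℝ ∞ (G.foldChart w) (G.seamChart w).center :=
  G.contDiffAt_foldChart (mem_ball_self (G.seamChart w).radius_pos)
    (by rw [symm_center]; exact G.retrVec_ne_zero_of_mem_seam (G.jA_sphereToBall_mem_seam w))

/-- Points of the seam hyperplane of the chart are seam points, and the fold-out map sends them
to their first-disc label. [folklore] -/
theorem foldChart_of_apply_zero {w : 𝕊 n} {u : 𝔼 (n + 1)}
    (hu : u ∈ ball (G.seamChart w).center (G.seamChart w).radius) (h0 : u 0 = 0) :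
    ∃ w' : 𝕊 n, G.jA (sphereToBall n w') = (G.seamChart w).chart.symm u ∧
      G.foldChart w u = w' := by
  obtain ⟨w', hw'⟩ := (G.seamChart w).exists_eq_symm_of_eq_zero hu h0
  exact ⟨w', hw', by rw [foldChart, comp_apply, ← hw', fold_jA_sphereToBall]⟩

/-- On the seam hyperplane of the chart, `foldLeftInv ∘ foldChart = id`. [folklore] -/
theorem foldLeftInv_foldChart {w : 𝕊 n} {u : 𝔼 (n + 1)}
    (hu : u ∈ ball (G.seamChart w).center (G.seamChart w).radius) (h0 : u 0 = 0) :
    G.foldLeftInv w (G.foldChart w u) = u := by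
  obtain ⟨w', hw', hF⟩ := G.foldChart_of_apply_zero hu h0
  rw [hF, foldLeftInv, radialProjection_coe_sphere, ← G.jA_sphereToBall, hw',
    (G.seamChart w).apply_symm hu]

/-! ### The height read in an adapted chart and its normal derivative -/

/-- The height read in the adapted chart at `w`. [folklore] -/
def heightChart (w : 𝕊 n) : (𝔼 (n + 1)) → ℝ := G.height ∘ (G.seamChart w).chart.symm

/-- The height in the chart is `C^∞` on the target ball. [folklore] -/
theorem contDiffAt_heightChart {w : 𝕊 n} {u : 𝔼 (n + 1)}
    (hu : u ∈ ball (G.seamChart w).center (G.seamChart w).radius) :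
    ContDiffAt ℝ ∞ (G.heightChart w) u :=
  G.contDiffAt_comp_symm hu G.contMDiff_height.contMDiffAt

/-- The height in the chart vanishes on the seam hyperplane. [folklore] -/
theorem heightChart_of_apply_zero {w : 𝕊 n} {u : 𝔼 (n + 1)}
    (hu : u ∈ ball (G.seamChart w).center (G.seamChart w).radius) (h0 : u 0 = 0) :
    G.heightChart w u = 0 := by
  obtain ⟨w', hw'⟩ := (G.seamChart w).exists_eq_symm_of_eq_zero hu h0
  rw [heightChart, comp_apply, ← hw']
  exact height_eq_zero_of_mem_seam (G.jA_sphereToBall_mem_seam w')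

/-- `‖foldChart u‖² = (1 + heightChart u)²`. [folklore] -/
theorem norm_foldChart_sq (w : 𝕊 n) (u : 𝔼 (n + 1)) :
    ‖G.foldChart w u‖ ^ 2 = (1 + G.heightChart w u) ^ 2 :=
  G.norm_fold_sq _

omit [T2Space P] in
/-- Small segments from the centre stay in the target ball. [folklore] -/
theorem eventually_lineMap_mem_ball (w : 𝕊 n) (v : 𝔼 (n + 1)) :
    ∀ᶠ s in 𝓝 (0 : ℝ), (G.seamChart w).center + s • v ∈
      ball (G.seamChart w).center (G.seamChart w).radius := by
  have hc : Continuous fun s : ℝ => (G.seamChart w).center + s • v := by fun_prop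
  have h0 : (G.seamChart w).center + (0 : ℝ) • v ∈
      ball (G.seamChart w).center (G.seamChart w).radius := by
    rw [zero_smul, add_zero]
    exact mem_ball_self (G.seamChart w).radius_pos
  exact hc.continuousAt.preimage_mem_nhds (isOpen_ball.mem_nhds h0)

/-- **The tangential derivatives of the height vanish on the seam.** [folklore] -/
theorem fderiv_heightChart_apply_of_apply_zero (w : 𝕊 n) {v : 𝔼 (n + 1)} (hv : v 0 = 0) :
    fderiv ℝ (G.heightChart w) (G.seamChart w).center v = 0 := by
  set S := G.seamChart w
  have hd : HasFDerivAt (G.heightChart w) (fderiv ℝ (G.heightChart w) S.center) S.center :=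
    ((G.contDiffAt_heightChart (mem_ball_self S.radius_pos)).differentiableAt (by simp)).hasFDerivAt
  refine hasFDerivAt_apply_eq_zero_of_eventually_const hd ?_
  filter_upwards [G.eventually_lineMap_mem_ball w v] with s hs
  rw [G.heightChart_of_apply_zero hs (by simp [(G.seamChart w).center_zero, hv]),
    G.heightChart_of_apply_zero (mem_ball_self S.radius_pos) S.center_zero]

/-- **The normal derivative of the height at a seam point is positive.** Choose `w₁` with
`ρ_{w₁} (jA w) > 0`; on the upper half ball the height dominates its summand
`ρ_{w₁} • heightLoc_{w₁}` (all summands are `≥ 0` there), both vanish at the centre, so the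
normal derivative of the height is at least `ρ_{w₁} (jA w)` times that of the local height,
which is positive. [folklore] -/
theorem fderiv_heightChart_baseVector_pos (w : 𝕊 n) :
    0 < fderiv ℝ (G.heightChart w) (G.seamChart w).center (closedBallBaseVector n) := by
  obtain ⟨w₁, hρ⟩ := G.seamPOU.exists_pos_of_mem (G.jA_sphereToBall_mem_seam w)
  have hw₁ : G.jA (sphereToBall n w) ∈ (G.seamChart w₁).chart.source :=
    G.mem_source_of_seamPOU_ne_zero hρ.ne'
  set ρc : (𝔼 (n + 1)) → ℝ := fun u => G.seamPOU w₁ ((G.seamChart w).chart.symm u) with hρc_def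
  have hρc : ContDiffAt ℝ ∞ ρc (G.seamChart w).center :=
    G.contDiffAt_comp_symm (mem_ball_self (G.seamChart w).radius_pos)
      (G.seamPOU w₁).contMDiff.contMDiffAt
  have hρc0 : ρc (G.seamChart w).center = G.seamPOU w₁ (G.jA (sphereToBall n w)) := by
    rw [hρc_def]; simp only; rw [symm_center]
  have hh : HasFDerivAt (G.heightLocChart w w₁)
      (fderiv ℝ (G.heightLocChart w w₁) (G.seamChart w).center) (G.seamChart w).center :=
    ((contDiffAt_heightLocChart hw₁).differentiableAt (by simp)).hasFDerivAt
  have hρcd : HasFDerivAt ρc (fderiv ℝ ρc (G.seamChart w).center) (G.seamChart w).center :=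
    (hρc.differentiableAt (by simp)).hasFDerivAt
  have hg : HasFDerivAt (fun u => ρc u * G.heightLocChart w w₁ u)
      (ρc (G.seamChart w).center • fderiv ℝ (G.heightLocChart w w₁) (G.seamChart w).center +
        G.heightLocChart w w₁ (G.seamChart w).center • fderiv ℝ ρc (G.seamChart w).center)
      (G.seamChart w).center := hρcd.mul hh
  have hH : HasFDerivAt (G.heightChart w) (fderiv ℝ (G.heightChart w) (G.seamChart w).center)
      (G.seamChart w).center :=
    ((G.contDiffAt_heightChart (mem_ball_self (G.seamChart w).radius_pos)).differentiableAt
      (by simp)).hasFDerivAt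
  -- comparison along the normal ray
  have hle := hasFDerivAt_le_of_eventually_le (v := closedBallBaseVector n) hH hg ?_ ?_
  · rw [heightLocChart_center hw₁, zero_smul, add_zero] at hle
    simp only [FunLike.coe_smul, Pi.smul_apply, hρc0, smul_eq_mul] at hle
    exact (mul_pos hρ (fderiv_heightLocChart_baseVector_pos hw₁)).trans_le hle
  · rw [heightLocChart_center hw₁, mul_zero]
    exact G.heightChart_of_apply_zero (mem_ball_self (G.seamChart w).radius_pos)
      (G.seamChart w).center_zero
  · filter_upwards [mem_nhdsWithin_of_mem_nhds (eventually_lineMap_mem_source hw₁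
      (closedBallBaseVector n)), self_mem_nhdsWithin] with s hs hs0
    obtain ⟨hs1, hs2⟩ := hs
    have hs0' : (0 : ℝ) < s := hs0
    have h0 : 0 ≤ ((G.seamChart w).center + s • closedBallBaseVector n) 0 := by
      simp [(G.seamChart w).center_zero, hs0'.le]
    have hB := (G.seamChart w).symm_mem_range_jB hs1 h0
    exact smul_heightLoc_le_height hB w₁

/-- **The radial component of the derivative of the fold-out map is the derivative of the
height**: `⟪fold (jA w), D(foldChart) v⟫ = D(heightChart) v`, from `‖foldChart‖² = (1 + heightChart)²`.
[folklore] -/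
theorem inner_fderiv_foldChart (w : 𝕊 n) (v : 𝔼 (n + 1)) :
    ⟪G.foldChart w (G.seamChart w).center, fderiv ℝ (G.foldChart w) (G.seamChart w).center v⟫ =
      fderiv ℝ (G.heightChart w) (G.seamChart w).center v := by
  set S := G.seamChart w
  set F := G.foldChart w
  set H := G.heightChart w
  have hF : HasFDerivAt F (fderiv ℝ F S.center) S.center :=
    ((G.contDiffAt_foldChart_center w).differentiableAt (by simp)).hasFDerivAt
  have hH : HasFDerivAt H (fderiv ℝ H S.center) S.center :=
    ((G.contDiffAt_heightChart (mem_ball_self S.radius_pos)).differentiableAt (by simp)).hasFDerivAt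
  have h1 : HasFDerivAt (fun u => 1 + H u) (fderiv ℝ H S.center) S.center := hH.const_add 1
  have hsq2 : HasFDerivAt (fun u => (1 + H u) * (1 + H u))
      ((1 + H S.center) • fderiv ℝ H S.center + (1 + H S.center) • fderiv ℝ H S.center) S.center :=
    h1.mul h1
  have hsq1 : HasFDerivAt (fun u => (1 + H u) * (1 + H u))
      (2 • (innerSL ℝ (F S.center)).comp (fderiv ℝ F S.center)) S.center := by
    refine hF.norm_sq.congr_of_eventuallyEq (Eventually.of_forall fun u => ?_)
    change (1 + H u) * (1 + H u) = ‖F u‖ ^ 2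
    rw [← pow_two]
    exact (G.norm_foldChart_sq w u).symm
  have heq := hsq1.unique hsq2
  have hH0 : H S.center = 0 := G.heightChart_of_apply_zero (mem_ball_self S.radius_pos) S.center_zero
  rw [hH0, add_zero, one_smul] at heq
  have := congrArg (fun T : (𝔼 (n + 1)) →L[ℝ] ℝ => T v) heq
  simp only [FunLike.coe_smul, FunLike.coe_add, Pi.smul_apply,
    Pi.add_apply, ContinuousLinearMap.comp_apply, innerSL_apply_apply] at this
  rw [two_smul] at this
  linarith

/-- **The tangential part of the derivative of the fold-out map is inverted by the derivative of
the tangential left inverse.** [folklore] -/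
theorem fderiv_foldLeftInv_fderiv_foldChart (w : 𝕊 n) {v : 𝔼 (n + 1)} (hv : v 0 = 0) :
    fderiv ℝ (G.foldLeftInv w) (w : 𝔼 (n + 1))
      (fderiv ℝ (G.foldChart w) (G.seamChart w).center v) = v := by
  have hF : HasFDerivAt (G.foldChart w) (fderiv ℝ (G.foldChart w) (G.seamChart w).center)
      (G.seamChart w).center :=
    ((G.contDiffAt_foldChart_center w).differentiableAt (by simp)).hasFDerivAt
  have hℓ : HasFDerivAt (G.foldLeftInv w) (fderiv ℝ (G.foldLeftInv w) (w : 𝔼 (n + 1)))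
      (G.foldChart w (G.seamChart w).center) := by
    rw [foldChart_center]
    exact ((G.contDiffAt_foldLeftInv w).differentiableAt (by simp)).hasFDerivAt
  refine hasFDerivAt_apply_apply_eq_of_eventually_leftInverse hF hℓ ?_
  filter_upwards [G.eventually_lineMap_mem_ball w v] with s hs
  exact G.foldLeftInv_foldChart hs (by simp [(G.seamChart w).center_zero, hv])

/-- **The derivative of the fold-out map at a seam point is injective** (hence invertible).
If `D(foldChart) v = 0` then the radial component gives `D(heightChart) v = 0`, whose tangential
part vanishes and whose normal part is `(v 0) · ∂₀ heightChart` with `∂₀ heightChart > 0`, so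
`v 0 = 0`; then `v` is tangential and `v = D(foldLeftInv) (D(foldChart) v) = 0`. [folklore] -/
theorem injective_fderiv_foldChart (w : 𝕊 n) :
    Injective (fderiv ℝ (G.foldChart w) (G.seamChart w).center) := by
  set S := G.seamChart w
  set L := fderiv ℝ (G.foldChart w) S.center
  refine (injective_iff_map_eq_zero L).2 fun v hv => ?_
  -- radial component
  have h1 : fderiv ℝ (G.heightChart w) S.center v = 0 := by
    rw [← G.inner_fderiv_foldChart w v]
    change ⟪G.foldChart w S.center, L v⟫ = 0
    rw [hv, inner_zero_right]
  -- normal part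
  have h2 : v 0 = 0 := by
    have hdec : fderiv ℝ (G.heightChart w) S.center v =
        (v 0) * fderiv ℝ (G.heightChart w) S.center (closedBallBaseVector n) +
          fderiv ℝ (G.heightChart w) S.center (flatten v) := by
      conv_lhs => rw [← smul_add_flatten v]
      rw [map_add, map_smul, smul_eq_mul]
    rw [G.fderiv_heightChart_apply_of_apply_zero w (flatten_apply_zero v), add_zero, h1] at hdec
    have hpos := G.fderiv_heightChart_baseVector_pos w
    rcases mul_eq_zero.1 hdec.symm with h | h
    · exact h
    · exact absurd h hpos.ne'
  -- tangential part
  have h3 := G.fderiv_foldLeftInv_fderiv_foldChart w h2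
  change fderiv ℝ (G.foldLeftInv w) (w : 𝔼 (n + 1)) (L v) = v at h3
  rw [hv, map_zero] at h3
  exact h3.symm

/-! ### Local inverses of the fold-out map -/

/-- The derivative of the fold-out map at the seam point `jA w`, read in the adapted chart, as a
continuous linear automorphism of `ℝⁿ⁺¹`. [folklore] -/
def foldChartDeriv (w : 𝕊 n) : (𝔼 (n + 1)) ≃L[ℝ] 𝔼 (n + 1) :=
  LinearEquiv.toContinuousLinearEquiv
    (LinearEquiv.ofInjectiveEndo (fderiv ℝ (G.foldChart w) (G.seamChart w).center).toLinearMap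
      (G.injective_fderiv_foldChart w))

/-- The automorphism is the derivative. [folklore] -/
@[simp] theorem coe_foldChartDeriv (w : 𝕊 n) :
    (G.foldChartDeriv w : (𝔼 (n + 1)) →L[ℝ] 𝔼 (n + 1)) =
      fderiv ℝ (G.foldChart w) (G.seamChart w).center := by
  ext v
  rfl

/-- The fold-out map in the chart has the (invertible) derivative `foldChartDeriv w` at the
centre. [folklore] -/
theorem hasFDerivAt_foldChart (w : 𝕊 n) :
    HasFDerivAt (G.foldChart w) (G.foldChartDeriv w : (𝔼 (n + 1)) →L[ℝ] 𝔼 (n + 1))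
      (G.seamChart w).center := by
  rw [coe_foldChartDeriv]
  exact ((G.contDiffAt_foldChart_center w).differentiableAt (by simp)).hasFDerivAt

/-- **A neighbourhood of the centre on which the fold-out map in the chart is `C^∞` with
invertible derivative** (invertibility is an open condition). [folklore] -/
theorem exists_foldChart_nhds (w : 𝕊 n) :
    ∃ O : Set (𝔼 (n + 1)), IsOpen O ∧ (G.seamChart w).center ∈ O ∧
      O ⊆ ball (G.seamChart w).center (G.seamChart w).radius ∧
      ContDiffOn ℝ ∞ (G.foldChart w) O ∧
      ∀ u ∈ O, ∃ e : (𝔼 (n + 1)) ≃L[ℝ] 𝔼 (n + 1),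
        HasFDerivAt (G.foldChart w) (e : (𝔼 (n + 1)) →L[ℝ] 𝔼 (n + 1)) u := by
  set S := G.seamChart w
  set O₁ : Set (𝔼 (n + 1)) := ball S.center S.radius ∩ S.chart.symm ⁻¹' {p : P | G.retrVec p ≠ 0}
    with hO₁
  have hO₁o : IsOpen O₁ := by
    have := S.chart.isOpen_inter_preimage_symm G.isOpen_retrVec_ne_zero
    rwa [S.target_eq] at this
  have hcO₁ : ContDiffOn ℝ ∞ (G.foldChart w) O₁ := fun u hu =>
    (G.contDiffAt_foldChart hu.1 hu.2).contDiffWithinAt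
  have hcont : ContinuousOn (fun u => fderiv ℝ (G.foldChart w) u) O₁ :=
    hcO₁.continuousOn_fderiv_of_isOpen hO₁o (by simp)
  set O := O₁ ∩ (fun u => fderiv ℝ (G.foldChart w) u) ⁻¹'
    range ((↑) : ((𝔼 (n + 1)) ≃L[ℝ] 𝔼 (n + 1)) → (𝔼 (n + 1)) →L[ℝ] 𝔼 (n + 1)) with hO
  refine ⟨O, hcont.isOpen_inter_preimage hO₁o ContinuousLinearEquiv.isOpen, ⟨⟨?_, ?_⟩, ?_⟩,
    fun u hu => hu.1.1, hcO₁.mono inter_subset_left, fun u hu => ?_⟩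
  · exact mem_ball_self S.radius_pos
  · change S.chart.symm S.center ∈ {p : P | G.retrVec p ≠ 0}
    rw [symm_center]
    exact G.retrVec_ne_zero_of_mem_seam (G.jA_sphereToBall_mem_seam w)
  · exact ⟨G.foldChartDeriv w, G.coe_foldChartDeriv w⟩
  · obtain ⟨e, he⟩ := hu.2
    refine ⟨e, ?_⟩
    rw [he]
    exact ((G.contDiffAt_foldChart hu.1.1 hu.1.2).differentiableAt (by simp)).hasFDerivAt

end BallGluingData

end Seam

end Literature.Topology.FourManifolds
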